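import Mathlib
import Summits.Ventures.PercRepro2.Defs
import Summits.Ventures.PercRepro2.Independence
import Summits.Ventures.PercRepro2.Graph
import Summits.Ventures.PercRepro2.Induced
import Summits.Ventures.PercRepro2.DisagreementSum
import Summits.Ventures.PercRepro2.DisagreementPinned
import Summits.Ventures.PercRepro2.TwoCopyBHK
import Summits.Ventures.PercRepro2.HullDefs
import Summits.Ventures.PercRepro2.HullFlip
import Summits.Ventures.PercRepro2.HullTheoremA
import Summits.Ventures.PercRepro2.HullCount
import Summits.Ventures.PercRepro2.LayerCake

/-!
# Row 2′DOM: stochastic domination of the blue cluster of `h` by the red one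
(blind cell PercRepro2, typer-1; lead g10 `LEAD-PROOFSHAPES.md` ADDENDUM 24 (31), post
2026-08-23T08:43:52Z)

On the minor `(G, z)` (free edges `G`, the rest pinned to `z`; second colouring `flipOn G ζ`) the
hull sum of `HullCount` generalises from the indicator `1[h ↔_B b] = 1[b ∈ C_B(h)]` to an arbitrary
function of the blue cluster of `h`:

* `domFunG f` = `Σ_{ζ = z off G} 1[h ∉ H_l] · s_{o,l}(ζ) · f(C_B(h))`, `domSumG 𝒰` = the same with
  `f = 1[· ∈ 𝒰]`;
* `DomRow` (row 2′DOM, up-set form): `domSumG 𝒰 ≥ 0` for every up-set `𝒰` of vertex sets and every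
  minor; `DomRowFun`: `domFunG f ≥ 0` for every monotone `f`;
* `domFunG_const` (the colour swap kills constants), `hullSumG_eq_domSumG` (the (BASE) instance
  `𝒰 = {S ∣ b ∈ S}`), **`hullRow_of_domRow` / `crossCount_of_domRow`**: 2′DOM implies row 2′HULL (i)
  = (BASE) on every minor;
* **`domRow_iff_domRowFun`**: the up-set form and the increasing-functional form are the same
  statement (layer cake `Lambda.nonneg_of_upperSet_indicators`, constants removed by the swap).
-/

namespace Summit.Ventures.PercRepro2

namespace Hull

open scoped Classical

variable {V : Type*} {E : Type*} [Fintype E] [DecidableEq E]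
  {R : Type*} [Field R] [LinearOrder R] [IsStrictOrderedRing R]

/-! ## The domination sums -/

/-- `Σ_{ζ = z off G} 1[h ∉ H_l] · s_{o,l}(ζ) · f(C_B(h))` on the minor `(G, z)`. -/
noncomputable def domFunG (R : Type*) [Ring R] (ends : E → Sym2 V) (G : Finset E) (z : Config E)
    (l o h : V) (f : Set V → R) : R :=
  ∑ ζ : Config E, if (∀ e, e ∉ G → ζ e = z e) then
    (if h ∉ hullG ends G ζ l then 1 else 0) * sideSignG R ends G ζ l o *
      f (cluster ends (flipOn G ζ) h) else 0

/-- `Σ_{ζ = z off G} 1[h ∉ H_l] · s_{o,l}(ζ) · 1[C_B(h) ∈ 𝒰]` on the minor `(G, z)`. -/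
noncomputable def domSumG (R : Type*) [Ring R] (ends : E → Sym2 V) (G : Finset E) (z : Config E)
    (l o h : V) (𝒰 : Set (Set V)) : R :=
  domFunG R ends G z l o h (fun S => if S ∈ 𝒰 then 1 else 0)

/-- **Row 2′DOM** (up-set form): on every minor, for every up-set `𝒰` of vertex sets,
`Σ 1[h ∉ H_l] · s_{o,l} · 1[C_B(h) ∈ 𝒰] ≥ 0` — the law of `C_B(h)` on `{h ∉ H_l, o ∈ B_side}` is
stochastically below its law on `{h ∉ H_l, o ∈ R_side}`. -/
def DomRow (R : Type*) [Ring R] [LinearOrder R] (ends : E → Sym2 V) (l o h : V) : Prop :=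
  ∀ (G : Finset E) (z : Config E) (𝒰 : Set (Set V)), IsUpperSet 𝒰 → 0 ≤ domSumG R ends G z l o h 𝒰

/-- **Row 2′DOM** (increasing-functional form): `Σ 1[h ∉ H_l] · s_{o,l} · f(C_B(h)) ≥ 0` for every
monotone `f` of the blue cluster of `h`, on every minor. -/
def DomRowFun (R : Type*) [Ring R] [LinearOrder R] (ends : E → Sym2 V) (l o h : V) : Prop :=
  ∀ (G : Finset E) (z : Config E) (f : Set V → R), Monotone f → 0 ≤ domFunG R ends G z l o h f

/-! ## Algebra of the functional -/

omit [LinearOrder R] [IsStrictOrderedRing R] in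
/-- `domFunG` is additive in `f`. -/
lemma domFunG_add (ends : E → Sym2 V) (G : Finset E) (z : Config E) (l o h : V)
    (f g : Set V → R) :
    domFunG R ends G z l o h (fun S => f S + g S) =
      domFunG R ends G z l o h f + domFunG R ends G z l o h g := by
  unfold domFunG
  rw [← Finset.sum_add_distrib]
  refine Finset.sum_congr rfl fun ζ _ => ?_
  split_ifs <;> ring

omit [LinearOrder R] [IsStrictOrderedRing R] in
/-- `domFunG` is homogeneous in `f`. -/
lemma domFunG_smul (ends : E → Sym2 V) (G : Finset E) (z : Config E) (l o h : V) (c : R)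
    (f : Set V → R) :
    domFunG R ends G z l o h (fun S => c * f S) = c * domFunG R ends G z l o h f := by
  unfold domFunG
  rw [Finset.mul_sum]
  refine Finset.sum_congr rfl fun ζ _ => ?_
  split_ifs <;> ring

/-- The colour swap `flipOn G` on the fibre kills every constant: `domFunG (fun _ => c) = 0`. -/
lemma domFunG_const (ends : E → Sym2 V) (G : Finset E) (z : Config E) (l o h : V) (c : R) :
    domFunG R ends G z l o h (fun _ => c) = 0 := by
  unfold domFunG
  have hneg : (∑ ζ : Config E, if (∀ e, e ∉ G → ζ e = z e) then
        (if h ∉ hullG ends G ζ l then 1 else 0) * sideSignG R ends G ζ l o * c else 0) =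
      -(∑ ζ : Config E, if (∀ e, e ∉ G → ζ e = z e) then
        (if h ∉ hullG ends G ζ l then 1 else 0) * sideSignG R ends G ζ l o * c else 0) := by
    rw [← Finset.sum_neg_distrib]
    refine Fintype.sum_bijective (flipOn G) (Function.Involutive.bijective (flipOn_flipOn G)) _ _ ?_
    intro ζ
    rw [hullG_flipOn, sideSignG_flipOn]
    by_cases hf : ∀ e, e ∉ G → ζ e = z e
    · rw [if_pos hf, if_pos ((fibre_flipOn G z ζ).2 hf)]
      ring
    · rw [if_neg hf, if_neg (fun h => hf ((fibre_flipOn G z ζ).1 h)), neg_zero]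
  have h2 : (2 : R) * (∑ ζ : Config E, if (∀ e, e ∉ G → ζ e = z e) then
      (if h ∉ hullG ends G ζ l then 1 else 0) * sideSignG R ends G ζ l o * c else 0) = 0 := by
    rw [two_mul]
    nth_rewrite 2 [hneg]
    ring
  exact (mul_eq_zero.1 h2).resolve_left two_ne_zero

omit [LinearOrder R] [IsStrictOrderedRing R] in
/-- `domSumG` is `domFunG` at the indicator of `𝒰`. -/
lemma domSumG_eq_indicator (ends : E → Sym2 V) (G : Finset E) (z : Config E) (l o h : V)
    (𝒰 : Set (Set V)) :
    domSumG R ends G z l o h 𝒰 = domFunG R ends G z l o h (𝒰.indicator 1) := by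
  unfold domSumG
  congr 1

/-! ## The (BASE) instance -/

omit [LinearOrder R] [IsStrictOrderedRing R] in
/-- The hull sum of (BASE) is the domination sum at the up-set `{S ∣ b ∈ S}`. -/
lemma hullSumG_eq_domSumG (ends : E → Sym2 V) (G : Finset E) (z : Config E) (l o h b : V) :
    hullSumG R ends G z l o h b = domSumG R ends G z l o h {S | b ∈ S} := by
  unfold hullSumG domSumG domFunG
  refine Finset.sum_congr rfl fun ζ _ => ?_
  simp only [Set.mem_setOf_eq, mem_cluster]

/-- `{S ∣ b ∈ S}` is an up-set of vertex sets. -/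
lemma isUpperSet_mem (b : V) : IsUpperSet {S : Set V | b ∈ S} :=
  fun _ _ hST hb => hST hb

omit [IsStrictOrderedRing R] in
/-- **2′DOM implies row 2′HULL (i)**: every hull sum is nonnegative. -/
theorem hullRow_of_domRow (ends : E → Sym2 V) (l o h b : V) (hd : DomRow R ends l o h) :
    HullRow R ends l o h b := by
  intro G z
  rw [hullSumG_eq_domSumG]
  exact hd G z _ (isUpperSet_mem b)

/-- **2′DOM implies (BASE) on every minor** (p1's `CrossCount`). -/
theorem crossCount_of_domRow (ends : E → Sym2 V) (l o h b : V) (hd : DomRow R ends l o h) :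
    CrossCount R ends l h o b :=
  (hullRow_iff_crossCount ends l o h b).1 (hullRow_of_domRow ends l o h b hd)

/-! ## Up-set form ⟺ increasing-functional form -/

section LayerCake

variable [Fintype V]

/-- The increasing-functional form for nonnegative monotone `f` (layer cake). -/
lemma domFunG_nonneg_of_domRow (ends : E → Sym2 V) (l o h : V) (hd : DomRow R ends l o h)
    (G : Finset E) (z : Config E) (f : Set V → R) (hf : Monotone f) (hf0 : ∀ S, 0 ≤ f S) :
    0 ≤ domFunG R ends G z l o h f :=
  Lambda.nonneg_of_upperSet_indicators (domFunG R ends G z l o h)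
    (domFunG_add ends G z l o h) (domFunG_smul ends G z l o h)
    (fun 𝒰 h𝒰 => by rw [← domSumG_eq_indicator]; exact hd G z 𝒰 h𝒰) _ f hf hf0 rfl

/-- **The up-set form gives the increasing-functional form**: `DomRow → DomRowFun` (subtract the
value at `∅`, which the colour swap kills). -/
theorem domRowFun_of_domRow (ends : E → Sym2 V) (l o h : V) (hd : DomRow R ends l o h) :
    DomRowFun R ends l o h := by
  intro G z f hf
  have hsplit : domFunG R ends G z l o h f =
      domFunG R ends G z l o h (fun S => f S - f ∅) + domFunG R ends G z l o h (fun _ => f ∅) := by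
    rw [← domFunG_add]
    congr 1
    funext S
    ring
  rw [hsplit, domFunG_const, add_zero]
  refine domFunG_nonneg_of_domRow ends l o h hd G z _ ?_ ?_
  · intro S T hST
    exact sub_le_sub_right (hf hST) _
  · intro S
    exact sub_nonneg.2 (hf (Set.empty_subset S))

omit [Fintype V] in
/-- **The increasing-functional form gives the up-set form**: `DomRowFun → DomRow`. -/
theorem domRow_of_domRowFun (ends : E → Sym2 V) (l o h : V) (hd : DomRowFun R ends l o h) :
    DomRow R ends l o h := by
  intro G z 𝒰 h𝒰
  unfold domSumG
  refine hd G z _ fun S T hST => ?_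
  by_cases hS : S ∈ 𝒰
  · rw [if_pos hS, if_pos (h𝒰 hST hS)]
  · rw [if_neg hS]
    split_ifs <;> norm_num

/-- **Row 2′DOM: the two forms are the same statement.** -/
theorem domRow_iff_domRowFun (ends : E → Sym2 V) (l o h : V) :
    DomRow R ends l o h ↔ DomRowFun R ends l o h :=
  ⟨domRowFun_of_domRow ends l o h, domRow_of_domRowFun ends l o h⟩

end LayerCake

/-! ## The free fibre -/

omit [LinearOrder R] [IsStrictOrderedRing R] in
/-- On the free fibre the domination functional is `Σ_ζ s_{o,l} · 1[h ∉ H_l] · f(C_B(h))` in the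
vocabulary of `HullDefs`. -/
lemma domFunG_univ (ends : E → Sym2 V) (z : Config E) (l o h : V) (f : Set V → R) :
    domFunG R ends Finset.univ z l o h f =
      ∑ ζ : Config E, sideSign R ends ζ l o * (if h ∉ hull ends ζ l then 1 else 0) *
        f (cluster ends (blue ζ) h) := by
  unfold domFunG
  refine Finset.sum_congr rfl fun ζ _ => ?_
  rw [if_pos (fun e he => absurd (Finset.mem_univ e) he), hullG_univ, sideSignG_univ, flipOn_univ]
  ring

end Hull

end Summit.Ventures.PercRepro2
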